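import Summits.CriticalPhenomena.PercolationContinuityZ3.Theorems.PercNearOneGluingNoHeavyLowerTailIncStarRootTargetCellsB
import HarnessLib

/-!
# The increasing star: the TARGET–TARGET Bernstein step, I — lifting through a pair away from the root, and the four-point cell dictionary

Support file for the Sahi programme (`--supports stmt-CriticalPhenomena-4575`, prover prim-sahi-p2 gen 13).  No definitions, no named facts, no
sorries, no `native_decide`; standard axioms.  Memo `run/shared/lean/prim/prim-sahi/FROM-prim-sahi-p2-gen13-INDEPENDENT-MARKS.md`, `prim-sahi-p2/PROOF-E3.md` §24.

For the increasing star `T(w) = E₃({a↔b},{a↔c},{a↔y})` under `prodBernoulli w` and the TARGET–TARGET pair `e = s(b,c)` (both endpoints are targets,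
neither is the root `a`), the cubic `p_e ↦ T` has mixed Bernstein coefficients `B₁ = polar₁(P_{w[e↦0]}, P_{w[e↦1]})`, `B₂ = polar₁(P_{w[e↦1]}, P_{w[e↦0]})`
(tree: `EdgeInduction.sahiE3_oneBond`).  Opening a pair `s(u,v)` joins `x` to `z` iff `x ↔ z` already, or `x` reaches `{u,v}` and `{u,v}` reaches `z`
(`insert_pair_mem_openConn_iff`, from `IncStar.reachable_insert_imp`; no distinctness of `u, v, x, z` is needed), so under `P_{w[e↦1]}` every hub event is
`P_{w[e↦0]}` of an explicit union/intersection of connection events of the four marked points, and both coefficients become cubic forms in the fifteen cells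
of the four-point law of `(a,b,c,y)` under `w[e↦0]` (tree: `FourPointAtoms.cell`).  This file supplies the lifting lemma and the "event = sum of cells" dictionary
(`tt_cl_*`) for the events met by the step `IncStar.targetTarget_polar_nonneg` (part II, `…IncStarTargetTargetStep`) — the fourteen polar-form events, the
increasing star of `w[e↦0]` (induction hypothesis) and the Harris pairs of its exact degree-3 cone certificate (kit job j168851 of this seat) — that are not
already in the root–target dictionary `IncStar.rt_cl_*` (…IncStarRootTargetCellsA/B, reused verbatim).
-/

noncomputable section

namespace Summit.CriticalPhenomena.PercolationContinuityZ3.Theorems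

namespace IncStar

open MeasureTheory Set Literature.Probability.Percolation Literature.Probability.LatticeModels EdgeInduction FourPointAtoms
open Summit.CriticalPhenomena.PercolationContinuityZ3.Cruxes.AdditiveGluing.TieLine.ConnAtoms
open scoped Classical

variable {V : Type*}

/-- **Lifting a connection through an arbitrary pair**: the configuration `ω ∪ {s(u,v)}` joins `x` to `z` iff `ω` does, or `ω` joins `x` to
one of `u, v` and one of `u, v` to `z`.  No distinctness hypotheses (for `u = v` the inserted loop is inert and the right-hand side still says `x ↔ z`). [folklore] -/
theorem insert_pair_mem_openConn_iff (ω : BondConfig V) (u v x z : V) :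
    insert s(u, v) ω ∈ openConn x z ↔
      ω ∈ openConn x z ∨ ((ω ∈ openConn x u ∨ ω ∈ openConn x v) ∧ (ω ∈ openConn u z ∨ ω ∈ openConn v z)) := by
  simp only [openConn, Set.mem_setOf_eq]
  constructor
  · exact reachable_insert_imp ω u v
  · have hle : openGraph ω ≤ openGraph (insert s(u, v) ω) := by
      intro p q hpq; rw [openGraph_adj] at hpq ⊢; exact ⟨Set.mem_insert_of_mem _ hpq.1, hpq.2⟩
    have huv : (openGraph (insert s(u, v) ω)).Reachable u v := by
      by_cases h : u = v
      · subst h; exact SimpleGraph.Reachable.refl _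
      · exact SimpleGraph.Adj.reachable (by rw [openGraph_adj]; exact ⟨Set.mem_insert _ _, h⟩)
    rintro (h | ⟨hx, hz⟩)
    · exact h.mono hle
    · rcases hx with hx | hx <;> rcases hz with hz | hz
      · exact (hx.mono hle).trans (hz.mono hle)
      · exact ((hx.mono hle).trans huv).trans (hz.mono hle)
      · exact ((hx.mono hle).trans huv.symm).trans (hz.mono hle)
      · exact (hx.mono hle).trans (hz.mono hle)

/-- Preimage form of `insert_pair_mem_openConn_iff`. [folklore] -/
theorem preimage_insert_pair_openConn (u v x z : V) :
    (fun ω : BondConfig V => insert s(u, v) ω) ⁻¹' openConn x z =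
      openConn x z ∪ ((openConn x u ∪ openConn x v) ∩ (openConn u z ∪ openConn v z)) := by
  ext ω
  simp only [Set.mem_preimage, Set.mem_union, Set.mem_inter_iff]
  exact insert_pair_mem_openConn_iff ω u v x z

variable {n : ℕ}

/-- `μ((((openConn a b ∪ ((openConn a b ∪ openConn a c) ∩ (openConn b b ∪ openConn c b))) ∩ (openConn a c ∪ ((openConn a b ∪ openConn a c) ∩ (openConn b c ∪ openConn c c)))) ∩ (openConn a y ∪ ((openConn a b ∪ openConn a c) ∩ (openConn b y ∪ openConn c y)))))` as a sum of four-point cells. [this work] -/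
theorem tt_cl_7 (w : Sym2 (Fin n) → unitInterval) (a b c y : Fin n) : (prodBernoulli w).real ((((openConn a b ∪ ((openConn a b ∪ openConn a c) ∩ (openConn b b ∪ openConn c b))) ∩ (openConn a c ∪ ((openConn a b ∪ openConn a c) ∩ (openConn b c ∪ openConn c c)))) ∩ (openConn a y ∪ ((openConn a b ∪ openConn a c) ∩ (openConn b y ∪ openConn c y))))) = cell w a b c y 9 + cell w a b c y 10 + cell w a b c y 11 + cell w a b c y 12 + cell w a b c y 14 := by
  rw [measureReal_eq_cellSum w a b c y (show HasPattern (quad a b c y) ((((openConn a b ∪ ((openConn a b ∪ openConn a c) ∩ (openConn b b ∪ openConn c b))) ∩ (openConn a c ∪ ((openConn a b ∪ openConn a c) ∩ (openConn b c ∪ openConn c c)))) ∩ (openConn a y ∪ ((openConn a b ∪ openConn a c) ∩ (openConn b y ∪ openConn c y))))) _ from (((((((oc a b c y 0 1 rfl rfl)).union ((((((oc a b c y 0 1 rfl rfl)).union ((oc a b c y 0 2 rfl rfl)))).inter ((((oc a b c y 1 1 rfl rfl)).union ((oc a b c y 2 1 rfl rfl)))))))).inter ((((oc a b c y 0 2 rfl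 rfl)).union ((((((oc a b c y 0 1 rfl rfl)).union ((oc a b c y 0 2 rfl rfl)))).inter ((((oc a b c y 1 2 rfl rfl)).union ((oc a b c y 2 2 rfl rfl)))))))))).inter ((((oc a b c y 0 3 rfl rfl)).union ((((((oc a b c y 0 1 rfl rfl)).union ((oc a b c y 0 2 rfl rfl)))).inter ((((oc a b c y 1 3 rfl rfl)).union ((oc a b c y 2 3 rfl rfl))))))))))]
  simp (config := {decide := true}) only [ite_true, ite_false, zero_add, add_zero]
/-- `μ((openConn a b ∪ ((openConn a b ∪ openConn a c) ∩ (openConn b b ∪ openConn c b))))` as a sum of four-point cells. [this work] -/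
theorem tt_cl_8 (w : Sym2 (Fin n) → unitInterval) (a b c y : Fin n) : (prodBernoulli w).real ((openConn a b ∪ ((openConn a b ∪ openConn a c) ∩ (openConn b b ∪ openConn c b)))) = cell w a b c y 5 + cell w a b c y 6 + cell w a b c y 9 + cell w a b c y 10 + cell w a b c y 11 + cell w a b c y 12 + cell w a b c y 13 + cell w a b c y 14 := by
  rw [measureReal_eq_cellSum w a b c y (show HasPattern (quad a b c y) ((openConn a b ∪ ((openConn a b ∪ openConn a c) ∩ (openConn b b ∪ openConn c b)))) _ from (((oc a b c y 0 1 rfl rfl)).union ((((((oc a b c y 0 1 rfl rfl)).union ((oc a b c y 0 2 rfl rfl)))).inter ((((oc a b c y 1 1 rfl rfl)).union ((oc a b c y 2 1 rfl rfl))))))))]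
  simp (config := {decide := true}) only [ite_true, ite_false, zero_add, add_zero]
/-- `μ((openConn a c ∪ ((openConn a b ∪ openConn a c) ∩ (openConn b c ∪ openConn c c))))` as a sum of four-point cells. [this work] -/
theorem tt_cl_9 (w : Sym2 (Fin n) → unitInterval) (a b c y : Fin n) : (prodBernoulli w).real ((openConn a c ∪ ((openConn a b ∪ openConn a c) ∩ (openConn b c ∪ openConn c c)))) = cell w a b c y 5 + cell w a b c y 6 + cell w a b c y 9 + cell w a b c y 10 + cell w a b c y 11 + cell w a b c y 12 + cell w a b c y 13 + cell w a b c y 14 := by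
  rw [measureReal_eq_cellSum w a b c y (show HasPattern (quad a b c y) ((openConn a c ∪ ((openConn a b ∪ openConn a c) ∩ (openConn b c ∪ openConn c c)))) _ from (((oc a b c y 0 2 rfl rfl)).union ((((((oc a b c y 0 1 rfl rfl)).union ((oc a b c y 0 2 rfl rfl)))).inter ((((oc a b c y 1 2 rfl rfl)).union ((oc a b c y 2 2 rfl rfl))))))))]
  simp (config := {decide := true}) only [ite_true, ite_false, zero_add, add_zero]
/-- `μ((openConn a y ∪ ((openConn a b ∪ openConn a c) ∩ (openConn b y ∪ openConn c y))))` as a sum of four-point cells. [this work] -/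
theorem tt_cl_10 (w : Sym2 (Fin n) → unitInterval) (a b c y : Fin n) : (prodBernoulli w).real ((openConn a y ∪ ((openConn a b ∪ openConn a c) ∩ (openConn b y ∪ openConn c y)))) = cell w a b c y 4 + cell w a b c y 8 + cell w a b c y 9 + cell w a b c y 10 + cell w a b c y 11 + cell w a b c y 12 + cell w a b c y 14 := by
  rw [measureReal_eq_cellSum w a b c y (show HasPattern (quad a b c y) ((openConn a y ∪ ((openConn a b ∪ openConn a c) ∩ (openConn b y ∪ openConn c y)))) _ from (((oc a b c y 0 3 rfl rfl)).union ((((((oc a b c y 0 1 rfl rfl)).union ((oc a b c y 0 2 rfl rfl)))).inter ((((oc a b c y 1 3 rfl rfl)).union ((oc a b c y 2 3 rfl rfl))))))))]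
  simp (config := {decide := true}) only [ite_true, ite_false, zero_add, add_zero]
/-- `μ(((openConn a c ∪ ((openConn a b ∪ openConn a c) ∩ (openConn b c ∪ openConn c c))) ∩ (openConn a y ∪ ((openConn a b ∪ openConn a c) ∩ (openConn b y ∪ openConn c y)))))` as a sum of four-point cells. [this work] -/
theorem tt_cl_11 (w : Sym2 (Fin n) → unitInterval) (a b c y : Fin n) : (prodBernoulli w).real (((openConn a c ∪ ((openConn a b ∪ openConn a c) ∩ (openConn b c ∪ openConn c c))) ∩ (openConn a y ∪ ((openConn a b ∪ openConn a c) ∩ (openConn b y ∪ openConn c y))))) = cell w a b c y 9 + cell w a b c y 10 + cell w a b c y 11 + cell w a b c y 12 + cell w a b c y 14 := by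
  rw [measureReal_eq_cellSum w a b c y (show HasPattern (quad a b c y) (((openConn a c ∪ ((openConn a b ∪ openConn a c) ∩ (openConn b c ∪ openConn c c))) ∩ (openConn a y ∪ ((openConn a b ∪ openConn a c) ∩ (openConn b y ∪ openConn c y))))) _ from (((((oc a b c y 0 2 rfl rfl)).union ((((((oc a b c y 0 1 rfl rfl)).union ((oc a b c y 0 2 rfl rfl)))).inter ((((oc a b c y 1 2 rfl rfl)).union ((oc a b c y 2 2 rfl rfl)))))))).inter ((((oc a b c y 0 3 rfl rfl)).union ((((((oc a b c y 0 1 rfl rfl)).union ((oc a b c y 0 2 rfl rfl)))).inter ((((oc a b c y 1 3 rfl rfl)).union ((oc a b c y 2 3 rfl rfl))))))))))]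
  simp (config := {decide := true}) only [ite_true, ite_false, zero_add, add_zero]
/-- `μ(((openConn a b ∪ ((openConn a b ∪ openConn a c) ∩ (openConn b b ∪ openConn c b))) ∩ (openConn a y ∪ ((openConn a b ∪ openConn a c) ∩ (openConn b y ∪ openConn c y)))))` as a sum of four-point cells. [this work] -/
theorem tt_cl_12 (w : Sym2 (Fin n) → unitInterval) (a b c y : Fin n) : (prodBernoulli w).real (((openConn a b ∪ ((openConn a b ∪ openConn a c) ∩ (openConn b b ∪ openConn c b))) ∩ (openConn a y ∪ ((openConn a b ∪ openConn a c) ∩ (openConn b y ∪ openConn c y))))) = cell w a b c y 9 + cell w a b c y 10 + cell w a b c y 11 + cell w a b c y 12 + cell w a b c y 14 := by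
  rw [measureReal_eq_cellSum w a b c y (show HasPattern (quad a b c y) (((openConn a b ∪ ((openConn a b ∪ openConn a c) ∩ (openConn b b ∪ openConn c b))) ∩ (openConn a y ∪ ((openConn a b ∪ openConn a c) ∩ (openConn b y ∪ openConn c y))))) _ from (((((oc a b c y 0 1 rfl rfl)).union ((((((oc a b c y 0 1 rfl rfl)).union ((oc a b c y 0 2 rfl rfl)))).inter ((((oc a b c y 1 1 rfl rfl)).union ((oc a b c y 2 1 rfl rfl)))))))).inter ((((oc a b c y 0 3 rfl rfl)).union ((((((oc a b c y 0 1 rfl rfl)).union ((oc a b c y 0 2 rfl rfl)))).inter ((((oc a b c y 1 3 rfl rfl)).union ((oc a b c y 2 3 rfl rfl))))))))))]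
  simp (config := {decide := true}) only [ite_true, ite_false, zero_add, add_zero]
/-- `μ(((openConn a b ∪ ((openConn a b ∪ openConn a c) ∩ (openConn b b ∪ openConn c b))) ∩ (openConn a c ∪ ((openConn a b ∪ openConn a c) ∩ (openConn b c ∪ openConn c c)))))` as a sum of four-point cells. [this work] -/
theorem tt_cl_13 (w : Sym2 (Fin n) → unitInterval) (a b c y : Fin n) : (prodBernoulli w).real (((openConn a b ∪ ((openConn a b ∪ openConn a c) ∩ (openConn b b ∪ openConn c b))) ∩ (openConn a c ∪ ((openConn a b ∪ openConn a c) ∩ (openConn b c ∪ openConn c c))))) = cell w a b c y 5 + cell w a b c y 6 + cell w a b c y 9 + cell w a b c y 10 + cell w a b c y 11 + cell w a b c y 12 + cell w a b c y 13 + cell w a b c y 14 := by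
  rw [measureReal_eq_cellSum w a b c y (show HasPattern (quad a b c y) (((openConn a b ∪ ((openConn a b ∪ openConn a c) ∩ (openConn b b ∪ openConn c b))) ∩ (openConn a c ∪ ((openConn a b ∪ openConn a c) ∩ (openConn b c ∪ openConn c c))))) _ from (((((oc a b c y 0 1 rfl rfl)).union ((((((oc a b c y 0 1 rfl rfl)).union ((oc a b c y 0 2 rfl rfl)))).inter ((((oc a b c y 1 1 rfl rfl)).union ((oc a b c y 2 1 rfl rfl)))))))).inter ((((oc a b c y 0 2 rfl rfl)).union ((((((oc a b c y 0 1 rfl rfl)).union ((oc a b c y 0 2 rfl rfl)))).inter ((((oc a b c y 1 2 rfl rfl)).union ((oc a b c y 2 2 rfl rfl))))))))))]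
  simp (config := {decide := true}) only [ite_true, ite_false, zero_add, add_zero]
/-- `μ((openConn a y ∩ openConn a c))` as a sum of four-point cells. [this work] -/
theorem tt_cl_14 (w : Sym2 (Fin n) → unitInterval) (a b c y : Fin n) : (prodBernoulli w).real ((openConn a y ∩ openConn a c)) = cell w a b c y 10 + cell w a b c y 14 := by
  rw [measureReal_eq_cellSum w a b c y (show HasPattern (quad a b c y) ((openConn a y ∩ openConn a c)) _ from (((oc a b c y 0 3 rfl rfl)).inter ((oc a b c y 0 2 rfl rfl))))]
  simp (config := {decide := true}) only [ite_true, ite_false, zero_add, add_zero]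
/-- `μ((openConn a y ∩ (openConn a b ∪ openConn a c)))` as a sum of four-point cells. [this work] -/
theorem tt_cl_15 (w : Sym2 (Fin n) → unitInterval) (a b c y : Fin n) : (prodBernoulli w).real ((openConn a y ∩ (openConn a b ∪ openConn a c))) = cell w a b c y 10 + cell w a b c y 12 + cell w a b c y 14 := by
  rw [measureReal_eq_cellSum w a b c y (show HasPattern (quad a b c y) ((openConn a y ∩ (openConn a b ∪ openConn a c))) _ from (((oc a b c y 0 3 rfl rfl)).inter ((((oc a b c y 0 1 rfl rfl)).union ((oc a b c y 0 2 rfl rfl))))))]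
  simp (config := {decide := true}) only [ite_true, ite_false, zero_add, add_zero]
/-- `μ((openConn a b ∪ openConn a c))` as a sum of four-point cells. [this work] -/
theorem tt_cl_16 (w : Sym2 (Fin n) → unitInterval) (a b c y : Fin n) : (prodBernoulli w).real ((openConn a b ∪ openConn a c)) = cell w a b c y 5 + cell w a b c y 6 + cell w a b c y 9 + cell w a b c y 10 + cell w a b c y 11 + cell w a b c y 12 + cell w a b c y 13 + cell w a b c y 14 := by
  rw [measureReal_eq_cellSum w a b c y (show HasPattern (quad a b c y) ((openConn a b ∪ openConn a c)) _ from (((oc a b c y 0 1 rfl rfl)).union ((oc a b c y 0 2 rfl rfl))))]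
  simp (config := {decide := true}) only [ite_true, ite_false, zero_add, add_zero]
/-- `μ((openConn a b ∩ (openConn a y ∪ openConn c y)))` as a sum of four-point cells. [this work] -/
theorem tt_cl_17 (w : Sym2 (Fin n) → unitInterval) (a b c y : Fin n) : (prodBernoulli w).real ((openConn a b ∩ (openConn a y ∪ openConn c y))) = cell w a b c y 11 + cell w a b c y 12 + cell w a b c y 14 := by
  rw [measureReal_eq_cellSum w a b c y (show HasPattern (quad a b c y) ((openConn a b ∩ (openConn a y ∪ openConn c y))) _ from (((oc a b c y 0 1 rfl rfl)).inter ((((oc a b c y 0 3 rfl rfl)).union ((oc a b c y 2 3 rfl rfl))))))]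
  simp (config := {decide := true}) only [ite_true, ite_false, zero_add, add_zero]
/-- `μ(((openConn a b ∪ openConn a y) ∩ (openConn a c ∪ openConn a y)))` as a sum of four-point cells. [this work] -/
theorem tt_cl_21 (w : Sym2 (Fin n) → unitInterval) (a b c y : Fin n) : (prodBernoulli w).real (((openConn a b ∪ openConn a y) ∩ (openConn a c ∪ openConn a y))) = cell w a b c y 4 + cell w a b c y 8 + cell w a b c y 10 + cell w a b c y 12 + cell w a b c y 13 + cell w a b c y 14 := by
  rw [measureReal_eq_cellSum w a b c y (show HasPattern (quad a b c y) (((openConn a b ∪ openConn a y) ∩ (openConn a c ∪ openConn a y))) _ from (((((oc a b c y 0 1 rfl rfl)).union ((oc a b c y 0 3 rfl rfl)))).inter ((((oc a b c y 0 2 rfl rfl)).union ((oc a b c y 0 3 rfl rfl))))))]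
  simp (config := {decide := true}) only [ite_true, ite_false, zero_add, add_zero]
/-- `μ((openConn a b ∪ openConn a y))` as a sum of four-point cells. [this work] -/
theorem tt_cl_22 (w : Sym2 (Fin n) → unitInterval) (a b c y : Fin n) : (prodBernoulli w).real ((openConn a b ∪ openConn a y)) = cell w a b c y 4 + cell w a b c y 6 + cell w a b c y 8 + cell w a b c y 10 + cell w a b c y 11 + cell w a b c y 12 + cell w a b c y 13 + cell w a b c y 14 := by
  rw [measureReal_eq_cellSum w a b c y (show HasPattern (quad a b c y) ((openConn a b ∪ openConn a y)) _ from (((oc a b c y 0 1 rfl rfl)).union ((oc a b c y 0 3 rfl rfl))))]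
  simp (config := {decide := true}) only [ite_true, ite_false, zero_add, add_zero]
/-- `μ((openConn a c ∪ openConn a y))` as a sum of four-point cells. [this work] -/
theorem tt_cl_23 (w : Sym2 (Fin n) → unitInterval) (a b c y : Fin n) : (prodBernoulli w).real ((openConn a c ∪ openConn a y)) = cell w a b c y 4 + cell w a b c y 5 + cell w a b c y 8 + cell w a b c y 9 + cell w a b c y 10 + cell w a b c y 12 + cell w a b c y 13 + cell w a b c y 14 := by
  rw [measureReal_eq_cellSum w a b c y (show HasPattern (quad a b c y) ((openConn a c ∪ openConn a y)) _ from (((oc a b c y 0 2 rfl rfl)).union ((oc a b c y 0 3 rfl rfl))))]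
  simp (config := {decide := true}) only [ite_true, ite_false, zero_add, add_zero]

end IncStar

end Summit.CriticalPhenomena.PercolationContinuityZ3.Theorems
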